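import Mathlib.Analysis.SpecialFunctions.SmoothTransition
import Mathlib.Topology.MetricSpace.Thickening
import Mathlib.MeasureTheory.Integral.Bochner.ContinuousLinearMap
import Literature.Analysis.FunctionSpaces.TorusPeriodizationCube
import Literature.Analysis.FunctionSpaces.TorusCalculusProofs
import HarnessLib

/-!
# Divergence-free fields supported inside the open unit cube have zero mean on the torus

Analysis/FunctionSpaces support file (torus calculus). The building blocks of the
Alberti–Crippa–Mazzucato / Bruè–De Lellis constructions are smooth divergence-free velocity
fields on `T²` *compactly supported in the open unit square* (Bruè–De Lellis, CMP 400 (2023),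
Thm. 4.1 (c); vendored in `Literature.Analysis.FluidPDE.alberti_crippa_mazzucato_quasi_self_similar`
as: `v(proj y) = 0` for every `y` of the fundamental cube `[0,1)^d` outside a compact
`K ⊂ (0,1)^d`). Such fields have **zero mean**, `∫_{T^d} v = 0` — the property of the drifts
recorded in `Literature.Analysis.FluidPDE.cheskidov_total_dissipation_family` — by the classical
identity `vᵢ = div(yᵢ v) - yᵢ div v = div(yᵢ v)` for a compactly supported divergence-free field
on `ℝ^d` (Majda–Bertozzi 2002, §1.1; the coordinate `yᵢ` is not a function on the torus, but a
smooth periodic substitute that equals `yᵢ` on the support of `v` does the job).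

Proof (`Torus.hasZeroMean_of_isDivFree_of_forall_eq_zero`): `K` has positive distance `δ` to
the boundary of the cube; `Torus.coordCutoff δ i (y) = yᵢ · ∏ⱼ p_δ(yⱼ)` with a smooth plateau
`p_δ = 1` on `[δ, 1-δ]`, `= 0` off `(δ/2, 1-δ/2)`, is smooth with support in the open cube, so
its periodisation `φᵢ = Torus.periodize (coordCutoff δ i)` (`TorusPeriodization`,
`TorusPeriodizationCube`) is a smooth
function on `T^d` whose lift agrees with `coordCutoff δ i` on the open cube and hence has gradient
`eᵢ` on `K`; therefore `⟪v, ∇φᵢ⟫ = vᵢ` everywhere on `T^d`, and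
`∫ vᵢ = ∫ ⟪v, ∇φᵢ⟫ = -∫ φᵢ div v = 0`
(`Torus.integral_inner_gradient_eq_neg_integral_mul_divergence_holds`).

## Library (placement, twins, design choices)

* The cube-supported periodisation facts used here — "one lattice term on the fundamental
  cube" and the support/closed-ball bookkeeping — are the accepted ones of
  `TorusPeriodizationCube` (`Torus.perSum_eq_self_of_mem_unitCube`,
  `Torus.support_subset_closedBall_of_cube`); this file only adds the bridge
  `Torus.coordCutoff_eq_zero_of_not_mem_openCube`.
* The other half of the Bruè–De Lellis §5 dictionary, `TorusCubeFieldTransfer`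
  (`integral_periodize_of_cube`: integrals of periodised cube-supported fields), transfers
  statements from `ℝ^d` to `T^d`; it does not apply here because the field `v` is *given on the
  torus* (only its vanishing off `proj K` is known), which is why the zero-mean statement is
  proved torus-side, with a periodised coordinate function as the auxiliary object.
* `Torus.plateau δ` is an explicit product of two rescaled `Real.smoothTransition`s (plateau
  `[δ, 1-δ]`, support in `(δ/2, 1-δ/2)`), in the style of the tree's `taoCutoff` / `radialCutoff`
  rather than Mathlib's `ContDiffBump` (which is centred on balls and would need `δ < 1/2`
  bookkeeping to fit the slab); the differently parametrised `plateau τ` of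
  `MathematicalPhysics/QuantumManyBody/PeriodicBoseGasScattering` lives in another namespace
  (no collision, different shape: plateau `[τ, 1+τ]`).
* Deliberately not here: any statement about the scalar `ρ` of BDL Thm. 4.1 (c) (its support
  clause is not needed for the mean), and no `ℝ^d`-side divergence theorem.

## References

* E. Bruè, C. De Lellis, *Anomalous dissipation for the forced 3D Navier–Stokes equations*,
  Comm. Math. Phys. 400 (2023), Thm. 4.1 (c).
* A. J. Majda, A. L. Bertozzi, *Vorticity and Incompressible Flow* (CUP 2002), §1.1
  (elementary identities for divergence-free fields).
-/

noncomputable section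

open MeasureTheory Set Filter Metric
open _root_.Topology
open scoped InnerProductSpace ContDiff

namespace Literature.Analysis.FunctionSpaces

namespace Torus

variable {d : Type*} [Fintype d] [DecidableEq d]

/-! ## A smooth plateau on `[δ, 1-δ]` supported in `(δ/2, 1-δ/2)` -/

/-- A smooth plateau function: for `δ > 0`, `plateau δ = 1` on `[δ, 1-δ]` and `= 0` off
`(δ/2, 1-δ/2)` (a product of two rescaled copies of Mathlib's `Real.smoothTransition`). [folklore] -/
def plateau (δ s : ℝ) : ℝ :=
  Real.smoothTransition ((s - δ / 2) / (δ / 2)) * Real.smoothTransition ((1 - δ / 2 - s) / (δ / 2))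

omit [Fintype d] [DecidableEq d] in
/-- The plateau is smooth. [folklore] -/
theorem contDiff_plateau (δ : ℝ) : ContDiff ℝ ∞ (plateau δ) := by
  unfold plateau
  exact (Real.smoothTransition.contDiff.comp ((contDiff_id.sub contDiff_const).div_const _)).mul
    (Real.smoothTransition.contDiff.comp ((contDiff_const.sub contDiff_id).div_const _))

omit [Fintype d] [DecidableEq d] in
/-- The plateau equals `1` on `[δ, 1-δ]`. [folklore] -/
theorem plateau_eq_one {δ s : ℝ} (hδ : 0 < δ) (hs : s ∈ Icc δ (1 - δ)) : plateau δ s = 1 := by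
  unfold plateau
  rw [Real.smoothTransition.one_of_one_le, Real.smoothTransition.one_of_one_le, one_mul]
  · rw [le_div_iff₀ (by positivity)]; linarith [hs.2]
  · rw [le_div_iff₀ (by positivity)]; linarith [hs.1]

omit [Fintype d] [DecidableEq d] in
/-- The plateau vanishes for `s ≤ δ/2`. [folklore] -/
theorem plateau_eq_zero_of_le {δ s : ℝ} (hδ : 0 < δ) (hs : s ≤ δ / 2) : plateau δ s = 0 := by
  unfold plateau
  rw [Real.smoothTransition.zero_of_nonpos, zero_mul]
  exact div_nonpos_of_nonpos_of_nonneg (by linarith) (by positivity)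

omit [Fintype d] [DecidableEq d] in
/-- The plateau vanishes for `s ≥ 1 - δ/2`. [folklore] -/
theorem plateau_eq_zero_of_ge {δ s : ℝ} (hδ : 0 < δ) (hs : 1 - δ / 2 ≤ s) : plateau δ s = 0 := by
  unfold plateau
  rw [Real.smoothTransition.zero_of_nonpos (x := (1 - δ / 2 - s) / (δ / 2)), mul_zero]
  exact div_nonpos_of_nonpos_of_nonneg (by linarith) (by positivity)

/-! ## The coordinate cutoff `yᵢ ∏ⱼ p_δ(yⱼ)` and its periodisation -/

/-- The **coordinate cutoff** `coordCutoff δ i (y) = yᵢ · ∏ⱼ plateau δ (yⱼ)`: a smooth function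
on `ℝ^d` equal to the coordinate `yᵢ` on the box `[δ, 1-δ]^d` and supported in
`(δ/2, 1-δ/2)^d` (the periodic substitute for the coordinate function in the identity
`vᵢ = div(yᵢ v)` for divergence-free `v`; Majda–Bertozzi 2002, §1.1). [folklore] -/
def coordCutoff (δ : ℝ) (i : d) (y : EuclideanSpace ℝ d) : ℝ :=
  y i * ∏ j, plateau δ (y j)

omit [DecidableEq d] in
/-- The coordinate cutoff is smooth. [folklore] -/
theorem contDiff_coordCutoff (δ : ℝ) (i : d) : ContDiff ℝ ∞ (coordCutoff δ i) := by
  unfold coordCutoff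
  have hc : ∀ j : d, ContDiff ℝ ∞ (fun y : EuclideanSpace ℝ d => y j) := fun j =>
    (EuclideanSpace.proj (𝕜 := ℝ) j).contDiff
  exact (hc i).mul (contDiff_prod fun j _ => (contDiff_plateau δ).comp (hc j))

omit [DecidableEq d] in
/-- The coordinate cutoff equals `yᵢ` on the box `[δ, 1-δ]^d`. [folklore] -/
theorem coordCutoff_eq_apply {δ : ℝ} (hδ : 0 < δ) (i : d) {y : EuclideanSpace ℝ d}
    (hy : ∀ j, y j ∈ Icc δ (1 - δ)) : coordCutoff δ i y = y i := by
  unfold coordCutoff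
  rw [Finset.prod_eq_one fun j _ => plateau_eq_one hδ (hy j), mul_one]

omit [DecidableEq d] in
/-- The coordinate cutoff vanishes as soon as one coordinate leaves `(δ/2, 1-δ/2)`. [folklore] -/
theorem coordCutoff_eq_zero {δ : ℝ} (hδ : 0 < δ) (i : d) {y : EuclideanSpace ℝ d} {j : d}
    (hj : y j ≤ δ / 2 ∨ 1 - δ / 2 ≤ y j) : coordCutoff δ i y = 0 := by
  unfold coordCutoff
  rw [Finset.prod_eq_zero (Finset.mem_univ j), mul_zero]
  rcases hj with hj | hj
  · exact plateau_eq_zero_of_le hδ hj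
  · exact plateau_eq_zero_of_ge hδ hj

omit [DecidableEq d] in
/-- The coordinate cutoff vanishes off the open unit cube `(0,1)^d` (a coordinate `≤ 0` is
`≤ δ/2`, a coordinate `≥ 1` is `≥ 1 - δ/2`): the hypothesis shape of the cube-supported
periodisation lemmas of `TorusPeriodizationCube`. [folklore] -/
theorem coordCutoff_eq_zero_of_not_mem_openCube {δ : ℝ} (hδ : 0 < δ) (i : d) :
    ∀ y : EuclideanSpace ℝ d, (¬ ∀ j, y j ∈ Ioo (0 : ℝ) 1) → coordCutoff δ i y = 0 := by
  intro y hy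
  rw [not_forall] at hy
  obtain ⟨j, hj⟩ := hy
  rw [mem_Ioo, not_and_or, not_lt, not_lt] at hj
  refine coordCutoff_eq_zero hδ i (j := j) ?_
  rcases hj with hj | hj
  · left; linarith
  · right; linarith

/-- The topological support of the coordinate cutoff lies in the closed ball of radius `card d`
(`Torus.support_subset_closedBall_of_cube`). [folklore] -/
theorem tsupport_coordCutoff_subset {δ : ℝ} (hδ : 0 < δ) (i : d) :
    tsupport (coordCutoff δ i) ⊆ closedBall (0 : EuclideanSpace ℝ d) (Fintype.card d) :=
  closure_minimal (support_subset_closedBall_of_cube (coordCutoff_eq_zero_of_not_mem_openCube hδ i))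
    isClosed_closedBall

/-- On the open unit cube the periodisation of the coordinate cutoff is the cutoff itself
(`Torus.perSum_eq_self_of_mem_unitCube`: all non-trivial lattice translates leave the open
cube). [folklore] -/
theorem perSum_coordCutoff_eq {δ : ℝ} (hδ : 0 < δ) (i : d) {y : EuclideanSpace ℝ d}
    (hy : ∀ j, y j ∈ Ioo (0 : ℝ) 1) : perSum (coordCutoff δ i) y = coordCutoff δ i y :=
  perSum_eq_self_of_mem_unitCube (coordCutoff_eq_zero_of_not_mem_openCube hδ i)
    fun j => Ioo_subset_Ico_self (hy j)

/-- The periodised coordinate cutoff `φᵢ = periodize (coordCutoff δ i)` is a smooth function on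
the torus. [folklore] -/
theorem isSmooth_periodize_coordCutoff {δ : ℝ} (hδ : 0 < δ) (i : d) :
    IsSmooth (periodize (coordCutoff δ i)) :=
  isSmooth_periodize (contDiff_coordCutoff δ i) (tsupport_coordCutoff_subset hδ i)

/-- **The gradient of the periodised coordinate cutoff is `eᵢ` deep inside the cube**: for `y`
in the open box `(δ, 1-δ)^d`, `∇(periodize (coordCutoff δ i))(proj y) = eᵢ` (there the lift
agrees with `yᵢ` on a neighbourhood). [folklore] -/
theorem gradient_periodize_coordCutoff {δ : ℝ} (hδ : 0 < δ) (i : d) {y : EuclideanSpace ℝ d}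
    (hy : ∀ j, y j ∈ Ioo δ (1 - δ)) :
    Torus.gradient (periodize (coordCutoff δ i)) (proj y) = EuclideanSpace.single i 1 := by
  -- near `y` the lattice sum is the coordinate function
  have hopen : IsOpen {z : EuclideanSpace ℝ d | ∀ j, z j ∈ Ioo δ (1 - δ)} := by
    have : {z : EuclideanSpace ℝ d | ∀ j, z j ∈ Ioo δ (1 - δ)} =
        ⋂ j, (fun z : EuclideanSpace ℝ d => z j) ⁻¹' Ioo δ (1 - δ) := by
      ext z; simp
    rw [this]
    exact isOpen_iInter_of_finite fun j => isOpen_Ioo.preimage (EuclideanSpace.proj (𝕜 := ℝ) j).continuous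
  have hev : perSum (coordCutoff δ i) =ᶠ[𝓝 y]
      (⇑(EuclideanSpace.proj (𝕜 := ℝ) i) : EuclideanSpace ℝ d → ℝ) := by
    filter_upwards [hopen.mem_nhds hy] with z hz
    have hz' : ∀ j, z j ∈ Ioo (0 : ℝ) 1 := fun j => ⟨hδ.trans (hz j).1, (hz j).2.trans_le (by linarith)⟩
    rw [perSum_coordCutoff_eq hδ i hz', coordCutoff_eq_apply hδ i fun j => Ioo_subset_Icc_self (hz j)]
    rfl
  refine ext_inner_right ℝ fun w => ?_
  rw [inner_gradient_left, ← fderiv_lift, lift_periodize, hev.fderiv_eq, ContinuousLinearMap.fderiv,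
    EuclideanSpace.inner_single_left]
  simp

/-! ## Zero mean -/

/-- A compact subset of the open unit cube keeps a positive distance `δ` from its faces: all its
points lie in the box `(δ, 1-δ)^d`. [folklore] -/
theorem exists_forall_mem_Ioo_of_isCompact {K : Set (EuclideanSpace ℝ d)} (hK : IsCompact K)
    (hKU : K ⊆ {y | ∀ i, y i ∈ Ioo (0 : ℝ) 1}) :
    ∃ δ : ℝ, 0 < δ ∧ ∀ y ∈ K, ∀ i, y i ∈ Ioo δ (1 - δ) := by
  have hopen : IsOpen {y : EuclideanSpace ℝ d | ∀ i, y i ∈ Ioo (0 : ℝ) 1} := by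
    have : {y : EuclideanSpace ℝ d | ∀ i, y i ∈ Ioo (0 : ℝ) 1} =
        ⋂ i, (fun y : EuclideanSpace ℝ d => y i) ⁻¹' Ioo 0 1 := by
      ext y; simp
    rw [this]
    exact isOpen_iInter_of_finite fun i => isOpen_Ioo.preimage (EuclideanSpace.proj (𝕜 := ℝ) i).continuous
  obtain ⟨ε, hε, hεU⟩ := hK.exists_thickening_subset_open hopen hKU
  refine ⟨ε / 2, by positivity, fun y hy i => ?_⟩
  have hmem : ∀ s : ℝ, |s| < ε → y + s • EuclideanSpace.single i (1 : ℝ) ∈ {y : EuclideanSpace ℝ d | ∀ i, y i ∈ Ioo (0 : ℝ) 1} := by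
    intro s hs
    refine hεU (Metric.mem_thickening_iff.2 ⟨y, hy, ?_⟩)
    rw [dist_eq_norm, add_sub_cancel_left, norm_smul, PiLp.norm_single, norm_one, mul_one, Real.norm_eq_abs]
    exact hs
  have happly : ∀ s : ℝ, (y + s • EuclideanSpace.single i (1 : ℝ)) i = y i + s := fun s => by simp
  have h1 := (hmem (ε / 2) (by rw [abs_of_pos (by positivity)]; linarith)) i
  have h2 := (hmem (-(ε / 2)) (by rw [abs_neg, abs_of_pos (by positivity)]; linarith)) i
  rw [happly] at h1 h2
  constructor <;> linarith [h1.2, h2.1]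

/-- **Divergence-free fields supported inside the open unit cube have zero mean** (Bruè–De Lellis
2023, Thm. 4.1 (c) ⇒ the drifts of the quasi-self-similar family have zero mean): if `v` is a
smooth divergence-free vector field on `T^d` and `v (proj y) = 0` for every `y` of the
fundamental cube `[0,1)^d` outside a compact `K ⊂ (0,1)^d`, then `∫_{T^d} v = 0`
(`vᵢ = ⟪v, ∇φᵢ⟫` for the periodised coordinate cutoff `φᵢ`, and `∫⟪v, ∇φᵢ⟫ = -∫ φᵢ div v = 0`;
Majda–Bertozzi 2002, §1.1). [folklore] -/
theorem hasZeroMean_of_isDivFree_of_forall_eq_zero {v : UnitAddTorus d → EuclideanSpace ℝ d}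
    (hv : IsSmooth v) (hdiv : IsDivFree v) {K : Set (EuclideanSpace ℝ d)} (hK : IsCompact K)
    (hKU : K ⊆ {y | ∀ i, y i ∈ Ioo (0 : ℝ) 1})
    (hzero : ∀ y ∈ unitCube d, y ∉ K → v (proj y) = 0) : HasZeroMean v := by
  obtain ⟨δ, hδ, hbox⟩ := exists_forall_mem_Ioo_of_isCompact hK hKU
  -- `⟪v, ∇φᵢ⟫ = vᵢ` everywhere
  have hkey : ∀ i x, ⟪v x, Torus.gradient (periodize (coordCutoff δ i)) x⟫_ℝ = v x i := by
    intro i x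
    by_cases hx : v x = 0
    · simp [hx]
    · have hrepr : repr x ∈ K := by
        by_contra hnot
        exact hx (by simpa [proj_repr] using hzero (repr x) (repr_mem_unitCube x) hnot)
      have hg := gradient_periodize_coordCutoff hδ i (hbox _ hrepr)
      rw [proj_repr] at hg
      rw [hg, EuclideanSpace.inner_single_right]
      simp
  -- integrate: `∫ vᵢ = ∫ ⟪v, ∇φᵢ⟫ = -∫ φᵢ div v = 0`
  have hcomp : ∀ i, ∫ x, v x i = 0 := by
    intro i
    have hφ := isSmooth_periodize_coordCutoff hδ i (d := d)
    have h1 := integral_inner_gradient_eq_neg_integral_mul_divergence_holds hv hφ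
    simp_rw [hkey i] at h1
    rw [h1]
    simp [show ∀ x, divergence v x = 0 from hdiv]
  rw [HasZeroMean]
  ext i
  rw [show (∫ x, v x) i = EuclideanSpace.proj (𝕜 := ℝ) i (∫ x, v x) from rfl,
    ← (EuclideanSpace.proj (𝕜 := ℝ) i).integral_comp_comm hv.integrable]
  simpa using hcomp i

end Torus

end Literature.Analysis.FunctionSpaces

end
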